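import Summits.BirchSwinnertonDyer.BirchSwinnertonDyer.Theorems.SignedLowerHalvesSprungLowerHalfAtThreeSplitConverseLocal
import Literature.NumberTheory.EllipticCurves.Sprung2024.ChromaticLocalInjectivityProofs
import Literature.NumberTheory.EllipticCurves.Sprung2012.LocalTowerNoPTorsionProofs
import Literature.NumberTheory.EllipticCurves.Sprung2024.ChromaticCharValueRankZeroProofs
import HarnessLib

/-!
# Crux 5 `SprungLowerHalfAtThree` and K2 `SharpFlatRankZeroConverseAtThree` with Sprung 2024 Lemma
# 5.5 (v = p) REPLACED by Sprung 2012 Prop. 7.3 / Prop. 7.6 (the `lem55AllN` input of the Kato-free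
# roads is now a theorem modulo the surjectivity of the two Coleman maps; Lemma 2.3 is a theorem)

Summit `BirchSwinnertonDyer`, sub-problem `BirchSwinnertonDyer`, route K3 `SignedLowerHalves`, crux 5 =
stmt-BirchSwinnertonDyer-19003 (split rev 13: K1 `SprungLowerDivisibilityAtThree` = 19875 OPEN, K2
`SharpFlatRankZeroConverseAtThree` = 19877, K3 `SharpFlatCharValueRankZeroAllLevels` = 19878, S4 =
19929). Cell `bsd-ssimc`, seat `bsd-ssimc-k3c5-kdot-split` g6, object «KDOT-L55-KERNEL»; theorems
only (`--supports stmt-BirchSwinnertonDyer-19003`). PARTITION: X8 (A8: `p = 3` good supersingular,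
`a₃ = ±3`, all conductors) × crux 5 split; proves-the-reduction-of; closes NONE; 0 census moves;
BSD is not proved by any of this.

The sibling `…SplitConverseLocal.lean` (g5) reduced K2 and crux 5 to the NAMED FACT
`Sprung2024.lem55AllN_sharpFlat_localKerOver_of_layerToInfty_mem` (Adv. Math. 449 p. 40, "`r_p` is
injective"; flag `Sprung24-§5.2-L5.5p-allN-local`). That fact is now a KERNEL THEOREM modulo two
verbatim, local, flag-free statements of Sprung, J. Number Theory 132 (2012) —
`Sprung2012.prop73_colemanFlat_surjective` (Prop. 7.3 "`Col♭` is surjective") and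
`Sprung2012.prop76_colemanSharp_surjective` (Prop. 7.6, `η` trivial: "`ε_η Col♯` is surjective") —
by `Sprung2024.lem55AllN_of_colemanSurjective` (`ChromaticLocalInjectivityProofs.lean`: Γ-twist of
Coleman pairs, `Col(z)(0) = 0` on `Ann(E(ℚ_p))`, Pontryagin separation for `ℤ_p`-valued functionals,
cocycle descent) together with the DISCHARGE of its third input, Sprung 2012 Lemma 2.3
(`Sprung2012.lem23_localTowerPoints_noPTorsion_holds`, `Sprung2012/LocalTowerNoPTorsionProofs.lean`,
cell `pub/bsd-cited`). Here the one-line compositions BY NAME: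

* `lem55AllN_of_prop73_prop76`, `lem56AllN_of_prop73_prop76` — Sprung 2024 Lemma 5.5 (v = p) and
  Lemma 5.6 ("if" half) ⟸ Prop. 7.3 ∧ Prop. 7.6;
* `sharpFlatRankZeroConverseAtThree_katoFree_of_prop73_prop76` — **K2 ⟸ K1 ∧ prop73 ∧ prop76 ∧
  modularity ∧ Thm. 2.2** (Kato-free (conv₀) road);
* `sprungLowerHalfAtThree_katoFree_of_prop73_prop76` — **crux 5 BY NAME ⟸ K1 ∧ prop73 ∧ prop76 ∧
  K3 ∧ modularity ∧ Thm. 2.2**.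

NET NAMED INPUTS of crux 5 along this road: K1 (`SprungLowerDivisibilityAtThree`, OPEN) + K3
(`= lem59AllN_…`, Sprung 2024 Lemma 5.9, flag `allN-via-RaySprung25`) + `exists_isNewformOf` (BCDT) +
Sprung 2012 {Thm. 2.2, Prop. 7.3, Prop. 7.6 (η = 1)} — three LOCAL statements about the formal group
of `E/ℚ_p` over the cyclotomic tower, verbatim and conductor-free in print. Sprung 2024 §5.2 Lemmas
5.5 (v = p) and 5.6, Sprung 2012 Lemma 2.3 and Thm. 7.14 are no longer named inputs on this road
(kernel theorems). CONDITIONAL on K1 (OPEN) and the named facts; closes nothing.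

## References
* [Sprung2024] F. Sprung, Adv. Math. 449 (2024) 109741, §5.2 pp. 39–41.
* [Sprung2012] F. Sprung, J. Number Theory 132 (2012): Thm. 2.2, Lemma 2.3 (p. 1487), Prop. 7.3
  (p. 1500), Prop. 7.6 (p. 1501), Main Conj. 7.21 (p. 1505).
* [BCDTJAMS2001] Breuil–Conrad–Diamond–Taylor, Thm. A (modularity).
-/

set_option autoImplicit false
-- justification: the mandated namespace `Summit.BirchSwinnertonDyer.BirchSwinnertonDyer.Theorems`
-- (single-conjunct summit, Sub = Summit) repeats a segment by design (D-0017).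
set_option linter.dupNamespace false

noncomputable section

open scoped Classical NumberField

open NumberField IsDedekindDomain WeierstrassCurve Literature.NumberTheory.EllipticCurves
  Literature.NumberTheory.EllipticCurves.ZpExtension Literature.NumberTheory.EllipticCurves.Sprung2017
  Literature.NumberTheory.EllipticCurves.Sprung2012 Literature.NumberTheory.EllipticCurves.Sprung2024
  Literature.NumberTheory.EllipticCurves.ModularForms Literature.NumberTheory.EllipticCurves.Rank1Residual
  Summit.BirchSwinnertonDyer.BirchSwinnertonDyer.Theses.SignedLowerHalves

namespace Summit.BirchSwinnertonDyer.BirchSwinnertonDyer.Theorems.SprungLowerHalfAtThreeSplit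

/-- **Sprung 2024 Lemma 5.5, case `v = p` (`lem55AllN_…`) ⟸ Sprung 2012 Prop. 7.3 ∧ Prop. 7.6**:
`lem55AllN_of_colemanSurjective` with its Lemma-2.3 input discharged
(`Sprung2012.lem23_localTowerPoints_noPTorsion_holds`).
[cite: Sprung2024, §5.2 proof of Lemma 5.5, case v = p (p. 40)]
[cite: Sprung2012, Prop. 7.3 (p. 1500), Prop. 7.6 (p. 1501), Lemma 2.3 (p. 1487)] -/
theorem lem55AllN_of_prop73_prop76 (h73 : prop73_colemanFlat_surjective)
    (h76 : prop76_colemanSharp_surjective) : lem55AllN_sharpFlat_localKerOver_of_layerToInfty_mem :=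
  lem55AllN_of_colemanSurjective h73 h76 Sprung2012.lem23_localTowerPoints_noPTorsion_holds

/-- **Sprung 2024 Lemma 5.6, "if" half (`lem56AllN_…`) ⟸ Sprung 2012 Prop. 7.3 ∧ Prop. 7.6**:
`lem56AllN_of_lem55AllN` composed with `lem55AllN_of_prop73_prop76`.
[cite: Sprung2024, §5.2 Lemma 5.6 and proof of Lemma 5.5 (pp. 40–41)]
[cite: Sprung2012, Prop. 7.3 (p. 1500), Prop. 7.6 (p. 1501)] -/
theorem lem56AllN_of_prop73_prop76 (h73 : prop73_colemanFlat_surjective)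
    (h76 : prop76_colemanSharp_surjective) :
    lem56AllN_sharpFlat_finite_coinvariants_of_finite_selmer :=
  lem56AllN_of_lem55AllN (lem55AllN_of_prop73_prop76 h73 h76)

/-- **K2 ⟸ K1 ∧ Sprung 2012 {Prop. 7.3, Prop. 7.6, Thm. 2.2} ∧ modularity** — the Kato-free (conv₀)
road `sharpFlatRankZeroConverseAtThree_katoFree_of_sprungLowerDivisibility_of_lem55` with its
`lem55AllN` input supplied by `lem55AllN_of_prop73_prop76`. CONDITIONAL on K1
(`SprungLowerDivisibilityAtThree`, OPEN) and the named facts; closes nothing.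
[cite: Sprung2024, §5.2 proof of Lemma 5.5 (p. 40), Lemma 5.6 (p. 41)]
[cite: Sprung2012, Thm. 2.2, Prop. 7.3, Prop. 7.6 and Main Conj. 7.21] [cite: BCDTJAMS2001, Thm. A] -/
theorem sharpFlatRankZeroConverseAtThree_katoFree_of_prop73_prop76
    (h73 : prop73_colemanFlat_surjective) (h76 : prop76_colemanSharp_surjective)
    (hmod : exists_isNewformOf) (h22 : Sprung2012.thm22_exists_isHondaSystem)
    (hK1 : SprungLowerDivisibilityAtThree) : SharpFlatRankZeroConverseAtThree :=
  sharpFlatRankZeroConverseAtThree_katoFree_of_sprungLowerDivisibility_of_lem55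
    (lem55AllN_of_prop73_prop76 h73 h76) hmod h22 hK1

/-- **Crux 5 BY NAME ⟸ K1 ∧ K3 ∧ Sprung 2012 {Prop. 7.3, Prop. 7.6, Thm. 2.2} ∧ modularity** —
`sprungLowerHalfAtThree_katoFree_of_namedFacts` (g5: no Thm. 7.14, no S4 bundle) with its
`lem55AllN` input supplied by `lem55AllN_of_prop73_prop76`. NET NAMED INPUTS: K1 (OPEN), K3
(`lem59AllN`), `exists_isNewformOf`, Sprung 2012 Thm. 2.2 / Prop. 7.3 / Prop. 7.6 — the Sprung 2024
§5.2 control lemmas 5.5 (v = p) / 5.6 and Sprung 2012 Lemma 2.3 are kernel theorems on this road.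
CONDITIONAL on K1 (OPEN) and the named facts; closes nothing; 0 cells move.
[cite: Sprung2024, §5.2 proof of Lemma 5.5 (p. 40), Lemmas 5.6–5.9 (p. 41)]
[cite: Sprung2012, Thm. 2.2, Prop. 7.3, Prop. 7.6, Prop. 6.14 and Main Conj. 7.21]
[cite: BCDTJAMS2001, Thm. A] -/
theorem sprungLowerHalfAtThree_katoFree_of_prop73_prop76 (h73 : prop73_colemanFlat_surjective)
    (h76 : prop76_colemanSharp_surjective) (hK3 : SharpFlatCharValueRankZeroAllLevels)
    (hmod : exists_isNewformOf) (h22 : Sprung2012.thm22_exists_isHondaSystem)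
    (hK1 : SprungLowerDivisibilityAtThree) : SprungLowerHalfAtThree :=
  sprungLowerHalfAtThree_katoFree_of_namedFacts (lem55AllN_of_prop73_prop76 h73 h76) hK3 hmod h22 hK1

/-! ## APPEND (seat `bsd-ssimc-k3c5-kdot-split` g7, object «KDOT-L59-ASSEMBLY»): K3 DERIVED

K3 `SharpFlatCharValueRankZeroAllLevels` (= `Sprung2024.lem59AllN_sharpFlatCharValue_rankZero` by name,
item stmt-BirchSwinnertonDyer-19878; Sprung 2024 §5.2 Lemmas 5.5 · 5.8 · 5.9 multiplied) is now a KERNEL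
THEOREM modulo Sprung 2024 **Lemma 5.5 alone** (`Sprung2024.lem55AllN_sharpFlat_coinvariants_card`,
`ChromaticCoinvariantsCard.lean`: "`1/|(Sel⋆_∞)_Γ| = (∏_{l bad} c_l^{(p)}/#E(ℚ)_p) × 1/|ker g|`", same flag
`Sprung24-§5.2-allN-via-RaySprung25`) and Sprung 2012 Props. 7.3 / 7.6 (inputs of this road already):
Lemmas 5.8 and 5.9 are kernel theorems for the tree's chromatic objects
(`Sprung2024/ChromaticEulerCharAssemblyProofs.lean`, `…/ChromaticCharValueRankZeroProofs.lean`). Hence the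
crux-5 road below, whose NET NAMED INPUTS are K1 (OPEN) + Sprung 2024 Lemma 5.5 (all `N`) +
`exists_isNewformOf` + Sprung 2012 {Thm. 2.2, Prop. 7.3, Prop. 7.6}; K3 leaves the list of named inputs
(derived). Lint note (REPORT-kdot-5 n1): this module disables exactly one linter, `linter.dupNamespace`
(l.55, D-0017 namespace repetition). CONDITIONAL on K1 (OPEN) and the named facts; closes nothing; 0 cells
move; BSD is not proved by any of this. -/

/-- **K3 BY NAME ⟸ Sprung 2024 Lemma 5.5 (all `N`) ∧ Sprung 2012 {Prop. 7.3, Prop. 7.6}** —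
`Sprung2024.lem59AllN_of_lem55AllNcard_of_prop73_prop76` read as the route decl
`SharpFlatCharValueRankZeroAllLevels` (which IS `lem59AllN_…`). Does not close item 19878 (conditional on
three named facts); records that K3's content beyond Lemma 5.5 is kernel mathematics.
[cite: Sprung2024, §5.2 Lemmas 5.5, 5.8, 5.9 and Proof of Thm. 5.3 (pp. 40–41)]
[cite: Sprung2012, Prop. 7.3 (p. 1500), Prop. 7.6 (p. 1501)] [cite: RaySprung2025, p. 2343] -/
theorem sharpFlatCharValueRankZeroAllLevels_of_lem55card_prop73_prop76
    (h73 : prop73_colemanFlat_surjective) (h76 : prop76_colemanSharp_surjective)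
    (h55 : lem55AllN_sharpFlat_coinvariants_card) : SharpFlatCharValueRankZeroAllLevels :=
  lem59AllN_of_lem55AllNcard_of_prop73_prop76 h55 h73 h76

/-- **Crux 5 BY NAME ⟸ K1 ∧ Sprung 2024 Lemma 5.5 ∧ Sprung 2012 {Prop. 7.3, Prop. 7.6, Thm. 2.2} ∧
modularity** — `sprungLowerHalfAtThree_katoFree_of_prop73_prop76` with its K3 input DERIVED
(`sharpFlatCharValueRankZeroAllLevels_of_lem55card_prop73_prop76`). NET NAMED INPUTS: K1
(`SprungLowerDivisibilityAtThree`, OPEN), `Sprung2024.lem55AllN_sharpFlat_coinvariants_card` (Lemma 5.5,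
all `N`), `exists_isNewformOf` (BCDT), Sprung 2012 Thm. 2.2 / Prop. 7.3 / Prop. 7.6. On this road Sprung
2024 §5.2 Lemmas 5.5 (v = p) / 5.6 / 5.7 / 5.8 / 5.9 and Sprung 2012 Lemma 2.3 / Thm. 7.14 are kernel
theorems. CONDITIONAL on K1 (OPEN) and the named facts; closes nothing; 0 cells move.
[cite: Sprung2024, §5.2 Lemmas 5.5–5.9 and Proof of Thm. 5.3 (pp. 40–41)]
[cite: Sprung2012, Thm. 2.2, Prop. 7.3, Prop. 7.6 and Main Conj. 7.21] [cite: BCDTJAMS2001, Thm. A] -/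
theorem sprungLowerHalfAtThree_katoFree_of_prop73_prop76_lem55card
    (h73 : prop73_colemanFlat_surjective) (h76 : prop76_colemanSharp_surjective)
    (h55 : lem55AllN_sharpFlat_coinvariants_card) (hmod : exists_isNewformOf)
    (h22 : Sprung2012.thm22_exists_isHondaSystem) (hK1 : SprungLowerDivisibilityAtThree) :
    SprungLowerHalfAtThree :=
  sprungLowerHalfAtThree_katoFree_of_prop73_prop76 h73 h76
    (sharpFlatCharValueRankZeroAllLevels_of_lem55card_prop73_prop76 h73 h76 h55) hmod h22 hK1

/-- **K2 is untouched by this append** (its road `sharpFlatRankZeroConverseAtThree_katoFree_of_prop73_prop76`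
never used K3); recorded for the reader as the pair of roads with identical local inputs:
(conv₀) ∧ crux 5 ⟸ K1 ∧ Lemma 5.5 ∧ {Prop. 7.3, Prop. 7.6, Thm. 2.2} ∧ modularity.
[cite: Sprung2024, §5.2 (pp. 39–41)] [cite: Sprung2012, Thm. 2.2, Prop. 7.3, Prop. 7.6] -/
theorem sharpFlatRankZeroConverse_and_sprungLowerHalfAtThree_of_prop73_prop76_lem55card
    (h73 : prop73_colemanFlat_surjective) (h76 : prop76_colemanSharp_surjective)
    (h55 : lem55AllN_sharpFlat_coinvariants_card) (hmod : exists_isNewformOf)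
    (h22 : Sprung2012.thm22_exists_isHondaSystem) (hK1 : SprungLowerDivisibilityAtThree) :
    SharpFlatRankZeroConverseAtThree ∧ SprungLowerHalfAtThree :=
  ⟨sharpFlatRankZeroConverseAtThree_katoFree_of_prop73_prop76 h73 h76 hmod h22 hK1,
    sprungLowerHalfAtThree_katoFree_of_prop73_prop76_lem55card h73 h76 h55 hmod h22 hK1⟩

end Summit.BirchSwinnertonDyer.BirchSwinnertonDyer.Theorems.SprungLowerHalfAtThreeSplit

end
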